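import Summits.MatrixMultiplication.OmegaCensus.USPWidth4SliceSound
import HarnessLib

/-!
# ω-census, family (b′) STPP / USP: the slice-structured checker for "no 8-row USP of width 4" — III: normalisation glue

HONEST FRAMING (pub-omega census; verbatim): lottery ticket; floor = certified bounds/negative ranges.
Census BOOKKEEPING machinery; no value of `ω` is touched here.  Continues `USPWidth4SliceSound.lean`.

From an arbitrary 8-code USP list (`USP8`) to the shape the checker refutes: (1) the SLICE LEMMA — a constant column of a USP can be deleted
(`pt_deleteCol`), so by `IsUSP.card_le_four_of_width_three` (`USPWidth3Maxima`) every column carries every symbol at most 4 times (`cnt_le_four`);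
(2) COUNT TRANSFER under `S₃ × S₄` (`cnt_map`, from the kit's verified action table); (3) the CASE ANALYSIS `no_usp8_of_patterns`: a transposition of
columns and one or two of symbols bring the list to column-3 slice sizes `(4,4,0), (4,3,1), (4,2,2)`, or — when no count is 4 — to `(3,3,2)` with all
counts `≤ 3`; (4) Q6-MINIMISATION (`exists_minimal`: the six column permutations fixing column 3 are closed under composition, so a least key exists
and is minimal) and SORTING (`sorted_good`: `List.insertionSort`, a permutation, meets `Rem`/`GoodE`), whence `no_usp8_of_pattern` from `top_sound`.
Part IV (`USPWidth4Maxima.lean`) supplies the certificate streams and runs the checker.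
-/

namespace Summit.MatrixMultiplication.OmegaCensus

open Literature.Computability.AlgebraicComplexity Equiv

namespace W4

/-! ## Part III — from an arbitrary 8-row USP to the normalised, sorted completion -/

/-- The number of codes of `D` whose digit `i` is `c`. [folklore] -/
def cnt (D : List ℕ) (i c : ℕ) : ℕ := D.countP fun x => dg x i == c

/-- An 8-code USP list: eight distinct codes `< 81` forming a USP. [folklore] -/
def USP8 (D : List ℕ) : Prop := D.length = 8 ∧ D.Nodup ∧ (∀ x ∈ D, x < 81) ∧ PZ false D

/-! ### The slice lemma: a constant column can be deleted, so every slice has at most 4 rows -/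

/-- Deleting a CONSTANT column keeps a USP a USP: a witnessing cell never sits in a constant column (no symbol passes the test against itself).
[cite: CohnKleinbergSzegedyUmans2005, §3 (p. 5), definition of a USP] -/
theorem pt_deleteCol {s : ℕ} {row : Fin s → Fin 4 → Fin 3} (h : PT false row) (i : Fin 4) (a : Fin 3) (hc : ∀ u, row u i = a) :
    PT false (fun u (j : Fin 3) => row u (i.succAbove j)) := by
  intro π₁ π₂ π₃
  rcases h π₁ π₂ π₃ with heq | ⟨u, i', hx⟩
  · exact Or.inl heq
  · right
    have hne : i' ≠ i := by rintro rfl; rw [hc, hc, hc] at hx; exact not_tst_self false a hx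
    obtain ⟨j, hj⟩ := Fin.exists_succAbove_eq hne
    refine ⟨u, j, ?_⟩
    dsimp only
    rw [hj]; exact hx

/-- **Slice bound**: in a USP code list, at most 4 codes share a digit in a fixed column (the slice, with that column deleted, is a width-3 USP,
and `IsUSP.card_le_four_of_width_three`). [cite: AndersonJiXu2020, Table 1 (k = 3)] -/
theorem cnt_le_four {D : List ℕ} (hP : PZ false D) (hnd : D.Nodup) (i : ℕ) (hi : i < 4) (c : ℕ) (hc : c < 3) : cnt D i c ≤ 4 := by
  let S := D.filter fun x => dg x i == c
  have hS : PZ false S := hP.subset (fun x hx => (List.mem_filter.1 hx).1) (hnd.filter _)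
  have hconst : ∀ u : Fin S.length, rowsOf S u ⟨i, hi⟩ = ⟨c, hc⟩ := fun u => by
    have hm : S.getD u.val 0 ∈ S := by rw [List.getD_eq_getElem _ _ u.isLt]; exact List.getElem_mem _
    have := (List.mem_filter.1 hm).2
    simp only [beq_iff_eq] at this
    exact Fin.ext this
  have h3 : IsUSP (fun u (j : Fin 3) => rowsOf S u ((⟨i, hi⟩ : Fin 4).succAbove j)) := (pt_false_iff _).1 (pt_deleteCol hS _ _ hconst)
  have := IsUSP.card_le_four_of_width_three h3
  unfold cnt; rw [List.countP_eq_length_filter]; exact this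

/-- The three digit counts of a column add up to the length. [folklore] -/
theorem cnt_sum (D : List ℕ) (i : ℕ) : cnt D i 0 + cnt D i 1 + cnt D i 2 = D.length := by
  induction D with
  | nil => simp [cnt]
  | cons x D ih =>
    simp only [cnt, List.countP_cons, List.length_cons] at ih ⊢
    have := dg_lt x i
    rcases (show dg x i = 0 ∨ dg x i = 1 ∨ dg x i = 2 by omega) with h | h | h <;> simp [h] <;> omega

/-! ### Digits and counts under the symmetry group -/

/-- Digits of an image code: `dg (actCode p q x) j = sym_p (dg x (col_q j))`. [folklore] -/
theorem dg_actCode {p q x : ℕ} (hp : p < 6) (hq : q < 24) (hx : x < 81) (j : ℕ) (hj : j < 4) :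
    dg (actCode p q x) j = symAt p (dg x (colAt q j % 4)) % 3 := by
  have h := actChecks_true
  unfold actChecks at h
  simp only [List.all_eq_true, List.mem_range, Bool.and_eq_true, decide_eq_true_eq, beq_iff_eq] at h
  exact (h p hp q hq x hx).2 j hj

/-- The preimage of symbol `c` under `sym_p`. [folklore] -/
def symInv (p c : ℕ) : ℕ := if symAt p 0 % 3 = c then 0 else if symAt p 1 % 3 = c then 1 else 2

/-- `symInv` is the preimage (checked over all `p < 6`, `c, a < 3`). [folklore] -/
theorem symInv_spec : ∀ p < 6, ∀ c < 3, ∀ a < 3, (symAt p a % 3 == c) = (a == symInv p c) := by decide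

/-- `symInv p c < 3`. [folklore] -/
theorem symInv_lt (p c : ℕ) : symInv p c < 3 := by unfold symInv; split_ifs <;> decide

/-- **Count transfer**: the count of symbol `c` in column `j` of the image is the count of `sym_p⁻¹ c` in column `col_q j`. [folklore] -/
theorem cnt_map {D : List ℕ} (h81 : ∀ x ∈ D, x < 81) {p q : ℕ} (hp : p < 6) (hq : q < 24) (j : ℕ) (hj : j < 4) (c : ℕ) (hc : c < 3) :
    cnt (D.map (actCode p q)) j c = cnt D (colAt q j % 4) (symInv p c) := by
  unfold cnt
  rw [List.countP_map]
  refine List.countP_congr fun x hx => ?_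
  simp only [Function.comp]
  rw [dg_actCode hp hq (h81 x hx) j hj, symInv_spec p hp c hc _ (dg_lt _ _)]

/-- Images of 8-code USP lists are 8-code USP lists. [cite: AndersonJiXu2020, §7 (Table 3, equivalence classes; arXiv:2301.00074v1)] -/
theorem USP8.map {D : List ℕ} (hD : USP8 D) {p q : ℕ} (hp : p < 6) (hq : q < 24) : USP8 (D.map (actCode p q)) := by
  obtain ⟨hl, hnd, h81, hP⟩ := hD
  refine ⟨by rw [List.length_map, hl], hnd.map_on fun x hx y hy hxy => actCode_inj hp hq (h81 x hx) (h81 y hy) hxy, fun y hy => ?_,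
    hP.map h81 hp hq⟩
  obtain ⟨x, hx, rfl⟩ := List.mem_map.1 hy
  exact actCode_lt hp hq (h81 x hx)

/-- Symbol permutation sending `c ↦ 0` (a transposition; index into `symTab`). [folklore] -/
def ps0 (c : ℕ) : ℕ := if c = 0 then 0 else if c = 1 then 2 else 5

/-- Symbol permutation sending `c ↦ 2` (a transposition). [folklore] -/
def ps2 (c : ℕ) : ℕ := if c = 0 then 5 else if c = 1 then 1 else 0

/-- Column permutation exchanging columns `i` and `3` (index into `colTab`). [folklore] -/
def qs3 (i : ℕ) : ℕ := if i = 0 then 21 else if i = 1 then 5 else if i = 2 then 1 else 0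

/-- The finite facts about these indices used below (ranges, where they send what). [folklore] -/
theorem swap_facts : (∀ c < 3, ps0 c < 6 ∧ ps2 c < 6 ∧ symInv (ps0 c) 0 = c ∧ symInv (ps2 c) 2 = c) ∧
    (∀ i < 4, qs3 i < 24 ∧ colAt (qs3 i) 3 % 4 = i) ∧ symInv 1 0 = 0 ∧ symInv 1 1 = 2 ∧ symInv 1 2 = 1 ∧
    (∀ j < 4, colAt 0 j % 4 = j) ∧ (∀ d < 3, symInv 0 d = d) := by
  refine ⟨?_, ?_, by decide, by decide, by decide, by decide, by decide⟩ <;> decide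

/-- The identity symbol permutation. [folklore] -/
theorem symAt_zero : ∀ a < 3, symAt 0 a % 3 = a := by decide

/-- Facts about the six column permutations fixing column 3: in range, closed under composition (on codes), column 3 and the range of
columns `0–2` are kept. [folklore] -/
theorem q6_facts : (∀ q ∈ q6, q < 24) ∧ (∀ q ∈ q6, colAt q 3 % 4 = 3) ∧ (∀ q ∈ q6, ∀ j < 3, colAt q j % 4 < 3) ∧
    (∀ q ∈ q6, ∀ q' ∈ q6, ∃ q'' ∈ q6, ∀ x < 81, actCode 0 q' (actCode 0 q x) = actCode 0 q'' x) := by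
  refine ⟨by decide, by decide, by decide, ?_⟩
  decide +kernel

/-- `x < 27 ↔` digit 3 is `0`; `x < 54 ↔` digit 3 is `0` or `1` (for `x < 81`). [folklore] -/
theorem lt_iff_dg {x : ℕ} (hx : x < 81) : (x < 27 ↔ dg x 3 = 0) ∧ (x < 54 ↔ dg x 3 = 0 ∨ dg x 3 = 1) := by
  unfold dg; rw [show (3 : ℕ) ^ 3 = 27 by norm_num]; omega

/-! ### Q6-minimisation and the sorted completion -/

/-- A function on a non-empty list attains a least value. [folklore] -/
theorem exists_le_all (f : ℕ → ℕ) : ∀ L : List ℕ, L ≠ [] → ∃ a ∈ L, ∀ b ∈ L, f a ≤ f b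
  | [], h => absurd rfl h
  | a :: L, _ => by
    by_cases hL : L = []
    · subst hL; exact ⟨a, by simp, fun b hb => by simp at hb; subst hb; exact le_refl _⟩
    · obtain ⟨m, hm, hmin⟩ := exists_le_all f L hL
      by_cases h : f a ≤ f m
      · refine ⟨a, by simp, fun b hb => ?_⟩
        rcases List.mem_cons.1 hb with rfl | hb
        · exact le_refl _
        · exact le_trans h (hmin b hb)
      · refine ⟨m, List.mem_cons_of_mem _ hm, fun b hb => ?_⟩
        rcases List.mem_cons.1 hb with rfl | hb
        · omega
        · exact hmin b hb

/-- For `q ∈ Q6` the slice-0 part of the image is the image of the slice-0 part. [folklore] -/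
theorem filter_map_q6 {D : List ℕ} (h81 : ∀ x ∈ D, x < 81) {q : ℕ} (hq : q ∈ q6) :
    (D.map (actCode 0 q)).filter (fun x => decide (x < 27)) = (D.filter fun x => decide (x < 27)).map (actCode 0 q) := by
  rw [List.filter_map]
  congr 1
  refine List.filter_congr fun x hx => ?_
  have hx81 := h81 x hx
  have hq24 := q6_facts.1 q hq
  have hy81 := actCode_lt (show 0 < 6 by decide) hq24 hx81
  have e : dg (actCode 0 q x) 3 = dg x 3 := by
    rw [dg_actCode (show 0 < 6 by decide) hq24 hx81 3 (by decide), q6_facts.2.1 q hq, symAt_zero _ (dg_lt _ _)]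
  simp only [Function.comp, decide_eq_decide]
  rw [(lt_iff_dg hy81).1, (lt_iff_dg hx81).1, e]


/-- **Q6-minimisation**: some column permutation fixing column 3 puts an 8-code USP list in Q6-minimal position. [folklore] -/
theorem exists_minimal {D : List ℕ} (h81 : ∀ x ∈ D, x < 81) : ∃ q ∈ q6, MinOK (D.map (actCode 0 q)) := by
  let f : ℕ → ℕ := fun q => msk ((D.map (actCode 0 q)).filter fun x => decide (x < 27))
  obtain ⟨q, hq, hmin⟩ := exists_le_all f q6 (by decide)
  refine ⟨q, hq, fun q' hq' => ?_⟩
  have h81' : ∀ y ∈ D.map (actCode 0 q), y < 81 := fun y hy => by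
    obtain ⟨x, hx, rfl⟩ := List.mem_map.1 hy; exact actCode_lt (by decide) (q6_facts.1 q hq) (h81 x hx)
  obtain ⟨q'', hq'', hcomp⟩ := q6_facts.2.2.2 q hq q' hq'
  have e : (D.map (actCode 0 q)).map (actCode 0 q') = D.map (actCode 0 q'') := by
    rw [List.map_map]; exact List.map_congr_left fun x hx => hcomp x (h81 x hx)
  rw [← filter_map_q6 h81' hq', e]
  exact hmin q'' hq''

/-- Pairwise `<` and counting of `<`-filters for lists. [folklore] -/
theorem countP_or_disj (f g : ℕ → Bool) (hfg : ∀ x, ¬ (f x = true ∧ g x = true)) :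
    ∀ L : List ℕ, L.countP (fun x => f x || g x) = L.countP f + L.countP g
  | [] => by simp
  | x :: L => by
    rw [List.countP_cons, List.countP_cons, List.countP_cons, countP_or_disj f g hfg L]
    have := hfg x
    cases hf : f x <;> cases hg : g x <;> simp_all <;> omega

/-- **The sorted completion**: a Q6-minimal 8-code USP list with slice sizes `(n₀, n01 − n₀, ·)` (and the cap condition if `cap`), sorted
increasingly, is a good completion of the empty node meeting the quotas. [folklore] -/
theorem sorted_good {D : List ℕ} (hD : USP8 D) {n0 n01 : ℕ} (hn01 : n0 ≤ n01) (h0 : cnt D 3 0 = n0) (h1 : cnt D 3 1 = n01 - n0)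
    {cap : Bool} (hcap : cap = true → CapOK D) (hmin : MinOK D) :
    Rem n0 n01 0 0 (D.insertionSort (· ≤ ·)) ∧ GoodE cap (D.insertionSort (· ≤ ·)) := by
  obtain ⟨hl, hnd, h81, hP⟩ := hD
  have p : (D.insertionSort (· ≤ ·)).Perm D := List.perm_insertionSort _ _
  have hndE : (D.insertionSort (· ≤ ·)).Nodup := p.nodup_iff.2 hnd
  refine ⟨⟨by rw [p.length_eq, hl], ?_, fun x hx => ⟨Nat.zero_le _, h81 x (p.mem_iff.1 hx)⟩, ?_, ?_⟩, ?_⟩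
  · have hle : (D.insertionSort (· ≤ ·)).Pairwise (· ≤ ·) := List.pairwise_insertionSort _ _
    exact (hle.and hndE).imp fun ⟨h1, h2⟩ => lt_of_le_of_ne h1 h2
  · rw [← List.countP_eq_length_filter, p.countP_eq, Nat.sub_zero, ← h0]
    exact List.countP_congr fun x hx => by rw [decide_eq_true_iff, beq_iff_eq]; exact (lt_iff_dg (h81 x hx)).1
  · rw [← List.countP_eq_length_filter, p.countP_eq, Nat.sub_zero, show n01 = cnt D 3 0 + cnt D 3 1 by omega]
    unfold cnt
    rw [← countP_or_disj _ _ (fun x ⟨ha, hb⟩ => by simp at ha hb; omega)]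
    exact List.countP_congr fun x hx => by
      rw [decide_eq_true_iff, Bool.or_eq_true, beq_iff_eq, beq_iff_eq]; exact (lt_iff_dg (h81 x hx)).2
  · exact GoodE.perm ⟨hnd, hP, hcap, hmin⟩ p.symm

/-- **One slice pattern**: if all 27 top runs of the checker pass for `(n₀, n01, cap)`, no 8-code USP list has column-3 slice sizes
`(n₀, n01 − n₀, ·)` (with the cap condition if `cap`) — move it into Q6-minimal position (slices and counts are kept), sort, `top_sound`. [folklore] -/
theorem no_usp8_of_pattern {GT n0 n01 : ℕ} {cap : Bool} {S : List ℕ} (hGT : goodTabOK GT = true) (hn0 : 0 < n0) (hn01 : n0 ≤ n01)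
    (hrun : ∀ a < 27, topRun GT n0 n01 cap a 1 (S.getD a 0) = true) {D : List ℕ} (hD : USP8 D) (h0 : cnt D 3 0 = n0)
    (h1 : cnt D 3 1 = n01 - n0) (hcap : cap = true → ∀ i < 3, ∀ d < 3, cnt D i d ≤ 3) : False := by
  obtain ⟨q, hq, hmin⟩ := exists_minimal hD.2.2.1
  have hq24 := q6_facts.1 q hq
  have hD' := hD.map (show 0 < 6 by decide) hq24
  have hc3 : ∀ c < 3, cnt (D.map (actCode 0 q)) 3 c = cnt D 3 c := fun c hc => by
    rw [cnt_map hD.2.2.1 (by decide) hq24 3 (by decide) c hc, q6_facts.2.1 q hq, swap_facts.2.2.2.2.2.2 c hc]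
  have hcap' : cap = true → CapOK (D.map (actCode 0 q)) := fun hc i hi d hd => by
    have e := cnt_map hD.2.2.1 (show 0 < 6 by decide) hq24 i (by omega) d hd
    unfold cnt at e
    rw [e, swap_facts.2.2.2.2.2.2 d hd]
    exact hcap hc _ (q6_facts.2.2.1 q hq i hi) d hd
  obtain ⟨hrem, hgood⟩ := sorted_good hD' hn01 ((hc3 0 (by decide)).trans h0) ((hc3 1 (by decide)).trans h1) hcap' hmin
  exact top_sound hGT hn0 hn01 hrun _ hrem hgood

/-- The hypothesis that slice pattern `(n₀, n01 − n₀, 8 − n01)` (with cap if `cap`) is excluded. [folklore] -/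
def PatGone (n0 n01 : ℕ) (cap : Bool) : Prop :=
  ∀ D, USP8 D → cnt D 3 0 = n0 → cnt D 3 1 = n01 - n0 → (cap = true → ∀ i < 3, ∀ d < 3, cnt D i d ≤ 3) → False

/-- **The case analysis**: excluding the four slice patterns `(4,4,0), (4,3,1), (4,2,2)` and `(3,3,2)`-with-cap excludes every 8-code USP list.
If some column carries a symbol 4 times, a transposition of columns and one of symbols makes it column 3 / symbol 0, and (after possibly
exchanging symbols 1, 2) the other two slice sizes are `(4,0), (3,1)` or `(2,2)`; otherwise every count is `≤ 3`, column 3's counts are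
`{3,3,2}`, and a symbol transposition puts the `2` at symbol 2. [folklore] -/
theorem no_usp8_of_patterns (h440 : PatGone 4 8 false) (h431 : PatGone 4 7 false) (h422 : PatGone 4 6 false) (h332 : PatGone 3 6 true)
    (D : List ℕ) (hD : USP8 D) : False := by
  have hle : ∀ E, USP8 E → ∀ i < 4, ∀ c < 3, cnt E i c ≤ 4 := fun E hE i hi c hc => cnt_le_four hE.2.2.2 hE.2.1 i hi c hc
  have hsum : ∀ E, USP8 E → ∀ i, cnt E i 0 + cnt E i 1 + cnt E i 2 = 8 := fun E hE i => by rw [cnt_sum, hE.1]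
  -- three sub-cases of case I, for a list already normalised to `cnt 3 0 = 4` with `cnt 3 2 ≤ cnt 3 1`
  have caseI : ∀ E, USP8 E → cnt E 3 0 = 4 → cnt E 3 2 ≤ cnt E 3 1 → False := fun E hE h0 hge => by
    have hs := hsum E hE 3
    have h41 := hle E hE 3 (by decide) 1 (by decide)
    rcases (show cnt E 3 1 = 4 ∨ cnt E 3 1 = 3 ∨ cnt E 3 1 = 2 by omega) with h | h | h
    · exact h440 E hE h0 (by rw [h]) (fun h => Bool.noConfusion h)
    · exact h431 E hE h0 (by rw [h]) (fun h => Bool.noConfusion h)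
    · exact h422 E hE h0 (by rw [h]) (fun h => Bool.noConfusion h)
  by_cases hex : ∃ i, i < 4 ∧ ∃ c, c < 3 ∧ cnt D i c = 4
  · obtain ⟨i, hi, c, hc, h4⟩ := hex
    obtain ⟨hp, -, hinv, -⟩ := swap_facts.1 c hc
    obtain ⟨hq, hcol⟩ := swap_facts.2.1 i hi
    have hD1 := hD.map hp hq
    have e0 : cnt (D.map (actCode (ps0 c) (qs3 i))) 3 0 = 4 := by
      rw [cnt_map hD.2.2.1 hp hq 3 (by decide) 0 (by decide), hcol, hinv, h4]
    by_cases hge : cnt (D.map (actCode (ps0 c) (qs3 i))) 3 2 ≤ cnt (D.map (actCode (ps0 c) (qs3 i))) 3 1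
    · exact caseI _ hD1 e0 hge
    · have hD2 := hD1.map (show 1 < 6 by decide) (show 0 < 24 by decide)
      have hsf := swap_facts
      refine caseI _ hD2 ?_ ?_
      · rw [cnt_map hD1.2.2.1 (by decide) (by decide) 3 (by decide) 0 (by decide), hsf.2.2.2.2.2.1 3 (by decide), hsf.2.2.1, e0]
      · rw [cnt_map hD1.2.2.1 (by decide) (by decide) 3 (by decide) 2 (by decide), cnt_map hD1.2.2.1 (by decide) (by decide) 3 (by decide) 1
          (by decide), hsf.2.2.2.2.2.1 3 (by decide), hsf.2.2.2.1, hsf.2.2.2.2.1]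
        omega
  · have h3 : ∀ i < 4, ∀ c < 3, cnt D i c ≤ 3 := fun i hi c hc => by
      have := hle D hD i hi c hc
      have hne : cnt D i c ≠ 4 := fun h => hex ⟨i, hi, c, hc, h⟩
      omega
    have hs := hsum D hD 3
    obtain ⟨c, hc, h2⟩ : ∃ c, c < 3 ∧ cnt D 3 c = 2 := by
      have a0 := h3 3 (by decide) 0 (by decide); have a1 := h3 3 (by decide) 1 (by decide); have a2 := h3 3 (by decide) 2 (by decide)
      rcases (show cnt D 3 0 = 2 ∨ cnt D 3 1 = 2 ∨ cnt D 3 2 = 2 by omega) with h | h | h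
      · exact ⟨0, by decide, h⟩
      · exact ⟨1, by decide, h⟩
      · exact ⟨2, by decide, h⟩
    obtain ⟨-, hp, -, hinv⟩ := swap_facts.1 c hc
    have hD1 := hD.map hp (show 0 < 24 by decide)
    have hcm : ∀ j < 4, ∀ d < 3, cnt (D.map (actCode (ps2 c) 0)) j d = cnt D j (symInv (ps2 c) d) := fun j hj d hd => by
      rw [cnt_map hD.2.2.1 hp (by decide) j hj d hd, swap_facts.2.2.2.2.2.1 j hj]
    have h3' : ∀ j < 4, ∀ d < 3, cnt (D.map (actCode (ps2 c) 0)) j d ≤ 3 := fun j hj d hd => by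
      rw [hcm j hj d hd]; exact h3 j hj _ (symInv_lt _ _)
    have e2 : cnt (D.map (actCode (ps2 c) 0)) 3 2 = 2 := by rw [hcm 3 (by decide) 2 (by decide), hinv, h2]
    have hs1 := hsum _ hD1 3
    have b0 := h3' 3 (by decide) 0 (by decide); have b1 := h3' 3 (by decide) 1 (by decide)
    exact h332 _ hD1 (by omega) (by omega) (fun _ j hj d hd => h3' j (by omega) d hd)

/-- From rows to code lists: an 8-row USP of width 4 gives an 8-code USP list (rows are distinct by `IsUSP.injective`). [folklore] -/
theorem usp8_of_isUSP (row : Fin 8 → Fin 4 → Fin 3) (h : IsUSP row) : USP8 (List.ofFn fun u => codeOf (row u)) := by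
  have hinj := h.injective
  refine ⟨List.length_ofFn, List.nodup_ofFn.2 (codeOf_injective.comp hinj), fun x hx => ?_, ?_⟩
  · obtain ⟨u, rfl⟩ := (List.mem_ofFn' _ _).1 hx; exact codeOf_lt _
  · have hlen : (List.ofFn fun u => codeOf (row u)).length = 8 := List.length_ofFn
    have hre := ((pt_false_iff row).2 h).restrict (Fin.cast hlen) (Fin.cast_injective hlen)
    have hrows : rowsOf (List.ofFn fun u => codeOf (row u)) = fun u i => row (Fin.cast hlen u) i := by
      funext u i
      simp only [rowsOf, List.getD_eq_getElem _ _ u.isLt, List.getElem_ofFn, rowOfCode_codeOf]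
      rfl
    unfold PZ; rw [hrows]; exact hre

end W4

end Summit.MatrixMultiplication.OmegaCensus
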